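import Mathlib
import HarnessLib
import HarnessLib.Audit
import Summits.CriticalPhenomena.Statement
import HarnessLib.Audit.Status.Attr

/-!
Route: LongRangeEndpoint

DORMANT since 2026-08-22T11:18:45Z (reconciler: no traction for 5.3 d (last activity item-evidence-added at 2026-08-17T03:45:10Z); parked, not closed — `ledger route dormant route-CriticalPhenomena-LongRangeEndpoint --off` to reactivate) — unstaffed, not closed; items shared with open routes are served there. `ledger route dormant <id> --off` reactivates.

LONG-RANGE ENDPOINT (idea card
CriticalPhenomena/Ising3DConformalLimit/long-range-crossover-endpoint). On the SAME lattice ℤ³ take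
the fractional-Laplacian Ising family J_α(x,y) := −((−Δ_ℤ³)^(α/2))_(x,y) for x ≠ y, 3/2 < α ≤ 2
(LongRangePhi4.fracLaplacianZd 3 (α/2), Slade2017 §2.1.1; the lattice regularisation of
Abdesselam2018Towards Conj. 5): ferromagnetic, reflection positive, J_α(x) ∼ c_α|x|^(−3−α), with
ISOTROPIC symbol λ(k)^(α/2) = |k|^α(1 + O(k²)) — and AT α = 2 IT IS EXACTLY THE NEAREST-NEIGHBOUR
COUPLING ((−Δ)¹ = −Δ). Take its critical free-b.c. zero-field state (the box limit of the free
finite-volume Gibbs states of the pair interaction J_α and β_c(α) := inf{β > 0 : m*(β) > 0},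
Panis2023Triviality §1.2.1 — written out INLINE in every item as a shared `let` header J / st / βc /
G / corr / Prot over Statement-cone primitives (box, glue, spinAt, spinMonomial; the Brillouin-zone
integral for (−Δ)^(α/2)); these are verbatim unfoldings of LongRangePhi4.fracLaplacianZd and
LongRangeIsing.state / criticalBeta / pairCorrelation, cone repair 2026-08-15, so the route file
imports nothing outside the Statement cone). Write G_α(x) for the critical two-point function,
Prot(α) for the PROTECTED-DIMENSION law c‖x‖^(−(3−α)) ≤ G_α(x) ≤ C‖x‖^(−(3−α)) (x ≠ 0; Δ(α) =
(3−α)/2, Fisher–Ma–Nickel/Sak), and α_* := sup {a ≤ 2 : Prot holds on (3/2, a)} for the variational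
crossover exponent (= 2 − η_SR ≈ 1.964 in the Sak–BRRZ picture; η_SR := 2 − α_* becomes an OUTPUT).
It suffices to show X: there are α_* ∈ (3/2, 2], a family S_α (3/2 < α < α_*) of pointwise scaling
limits of the critical J_α-correlators, each Möbius covariant with the protected dimension Δ(α) =
(3−α)/2, converging pointwise (every n, every configuration) as α ↑ α_* to a family T which is a
pointwise scaling limit of the nearest-neighbour critical correlators criticalCorr 3 (+ state,
β_c(3)), with T₂ > 0 off the diagonal and U₄(T) ≢ 0.
X → Ising3DConformalLimit is elementary CLOSEDNESS: with Δ := (3−α_*)/2 > 0 each Möbius identity for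
S_α passes to the limit α ↑ α_* (continuity of a ↦ c^(−nΔ(a)) and of a ↦ ∏‖z_i‖^(2Δ(a)), uniqueness
of limits along 𝓝[<] α_*) — support item ThesisSuffices, PROVED in the planner's Sketch.lean. X is
reached from four ranked cruxes — LRWindowConformal (Prot(α) ⇒ a conformal, non-Gaussian limit with
the protected Δ(α), normalised), EndpointIsNearestNeighbour (the α ↑ α_* limit T of the normalised
LR limits IS the n.n. scaling limit), EndpointContinuity (that limit T exists pointwise and is
non-degenerate and non-Gaussian), ProtectedWindow (α_* > 3/2) — and Assembly = LRWindowConformal →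
ProtectedWindow → EndpointContinuity → EndpointIsNearestNeighbour → Ising3DConformalLimit is PROVED
in Sketch.lean from the four defs (isLUB_csSup / le_csSup / exists_lt_of_lt_csSup for α_*, `choose`
of the normalised family on the window, then ThesisSuffices; axioms propext / Classical.choice /
Quot.sound only). So the two glue items close at once and the route stands or falls with the four
cruxes.
Lean: `open Literature.Probability.LatticeModels in let J : ℝ → Site 3 → Site 3 → ℝ := fun a x y =>
if x = y then (0 : ℝ) else -(((2 * Real.pi) ^ 3)⁻¹ * ∫ k in Set.pi Set.univ (fun _ : Fin 3 =>
Set.Icc (-Real.pi) Real.pi), (2 * ∑ i, (1 - Real.cos (k i))) ^ (a / 2) * Real.cos (∑ j, k j * ((x j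
: ℝ) - (y j : ℝ)))); let st : ℝ → ℝ → ℝ → (SpinConfig (Site 3) → ℝ) → ℝ := fun a β h F => limUnder
atTop (fun L : ℕ => let Λ := box 3 L; let w : (↥Λ → ℤˣ) → ℝ := fun τ => Real.exp (-β * (-(∑ x ∈ Λ, ∑
y ∈ Λ, J a x y * spinAt x (glue Λ τ .free) * spinAt y (glue Λ τ .free)) / 2 - h * ∑ x ∈ Λ, spinAt x
(glue Λ τ .free))); (∑ τ, F (glue Λ τ .free) * w τ) / ∑ τ, w τ); let βc : ℝ → ℝ := fun a => sInf {β
: ℝ | 0 < β ∧ 0 < limUnder (𝓝[>] (0 : ℝ)) (fun h : ℝ => st a β h (spinAt 0))}; let corr : ℝ → (n :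
ℕ) → (Fin n → Site 3) → ℝ := fun a _ y => st a (βc a) 0 (spinMonomial y); ∃ αs ∈ Set.Ioc (3 / 2 : ℝ)
2, ∃ (S : ℝ → CorrFamily 3) (T : CorrFamily 3), (∀ a ∈ Set.Ioo (3 / 2 : ℝ) αs, (∃ ρ : ℝ → ℝ, (∀ δ ∈
Set.Ioc (0 : ℝ) 1, 0 < ρ δ) ∧ HasPointwiseScalingLimit (corr a) ρ (S a)) ∧ IsMoebiusCovariant ((3 -
a) / 2) (S a)) ∧ (∀ (n : ℕ) (z : Fin n → EuclideanSpace ℝ (Fin 3)), Filter.Tendsto (fun a : ℝ => S a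
n z) (𝓝[<] αs) (𝓝 (T n z))) ∧ (∃ ρ : ℝ → ℝ, (∀ δ ∈ Set.Ioc (0 : ℝ) 1, 0 < ρ δ) ∧
HasPointwiseScalingLimit (criticalCorr 3) ρ T) ∧ IsNondegenerateTwoPoint T ∧ HasNontrivialU4 T`

Rationale: WHY THIS LINE. The conjunct asks ℤ³ for two inputs no native tool supplies: an a-priori spin
dimension Δ and the special conformal generator (inversion). Along the long-range family both hold
for STRUCTURAL reasons: Δ(α) = (3−α)/2 is protected — the non-local kinetic term |k|^α is not
renormalised (FisherMaNickel1972, Sak1973; rigorous at α = (3+ε)/2 for the weakly coupled |φ|⁴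
version of exactly this lattice model: LohmannSladeWallace2017 Thm 1.1, Slade2017 Thm 1.4.1) — and
the long-range fixed point is Möbius covariant WITHOUT a local stress tensor (PaulosEtAl2016 =
arXiv:1509.00008; BehanEtAl2017 §4.3 p.17; Abdesselam2018Towards Conj. 4 (global CI of the BMS fixed
point, [φ] = (3−ε)/4 = (3−α)/2) and Conj. 5 (±1 lattice realisation with the fractional-Laplacian
coupling); for long-range PERCOLATION up-to-constants Möbius covariance with dimension (d−α)/2 is
already a non-perturbative theorem in the LR-LD regime, Hutchcroft2025 Cor. II.1.17 p.18). The
kernel is chosen ISOTROPIC on purpose: Hutchcroft2025 Remark II.1.18 warns that kernels ∝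
‖x−y‖₁^(−d−α) (Panis's algebraicCoupling, the family of the barrier LongRangeTrivialityOnZ3) 'are
not expected to yield rotationally-invariant scaling limits' in the LR regime — the protected
non-local term inherits the kernel's angular dependence — so Möbius covariance along the window
needs λ(k)^(α/2) ∼ |k|^α; the same choice makes the endpoint literal: J_2 is the nearest-neighbour
model. The n.n. model is then reached on the same lattice by one real parameter: Sak's crossover at
α_* = 2 − η_SR ('the crossover happens continuously and at s = s_*', BehanEtAl2017 §1.1 p.4; 'α_c(d)
= 2 − η_SR … morally related to very strong forms of universality for short-range models',
Hutchcroft2025 p.6); for α_* < α ≤ 2 the LR tail is RG-irrelevant and J_α sits in the n.n. class,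
J_2 being the n.n. model itself. Möbius covariance is TRANSPORTED BY CLOSEDNESS under pointwise
limits, never by a Euclidean ⇒ Möbius upgrade (the refuted IsingEuclidUpgrade (U) and the barrier
ScaleCovarianceNotMoebius are not on this path). Areas imported: rigorous RG of long-range models
(anchor of crux #2 at small ε, not the engine), conformal perturbation theory of the LR→SR crossover
(BehanEtAl2017; physics, explicit dictionary: lattice spin ↦ φ = LR field; near α_*, LRFP = SRFP +
Gaussian χ coupled by g∫σχ, g_*² ∝ α_*−α; φ → σ_SR as g_* → 0), non-perturbative two-point methods
for long-range models (Hutchcroft2022/2024/2025), reflection positivity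
(FrohlichIsraelLiebSimon1978; RP of J_α by the resolvent superposition −((−Δ+m²)^s)_(0n) = (sin
πs/π)∫₀^∞ u^s ((−Δ+m²+u)⁻¹)_(0n) du, fibrewise in the transverse momentum a positive mixture of
exponentials, hence Hankel-positive). Abdesselam's programme works at 'the other, more
mathematically tractable end 0 < ε ≪ 1' and names the ε ∼ 1 end 'the transition into the more
mysterious scaling limit for the 3D short-range Ising model' (Abdesselam2018Towards p.8): this route
is that end, made a statement. Inspiration notes (docs/m5/inspiration) NOT read (plancard mode).
RANKED CRUXES. #2 LRWindowConformal — for 3/2 < α < 2, Prot(α) ⇒ the critical J_α-correlators have a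
pointwise scaling limit S, Möbius covariant with Δ = (3−α)/2, S₂ > 0, U₄ ≢ 0 (normalised: S₂(0,e₁) =
1, S = 0 on coincident configurations — conventions any witness can be given by S ↦
κⁿS·𝟙_NonCoincident). Hardest and most informative: a non-Gaussian conformal theory realised on ℤ³
with KNOWN Δ; = Abdesselam Conj. 4+5 beyond small ε (why it might fail: no construction of the LR
fixed point for ±1 spins at any ε; full δ→0⁺ limit = uniqueness; Möbius w/o stress tensor rests on
PRvRZ's all-orders argument). #3 EndpointIsNearestNeighbour — with α_* the least upper bound of {a ≤
2 : Prot on (3/2,a)} and α_* > 3/2: if the normalised LR limits S_α converge pointwise as α ↑ α_* to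
T, then T is a pointwise scaling limit of criticalCorr 3 for some ρ > 0: short-range universality on
ℤ³ along (α_*, 2] (J_2 = n.n.) joined to the endpoint from the left, plus existence of the n.n.
limit — 'no engine' (card audit), 'out of reach of current techniques even for d = 2'
(Hutchcroft2025 p.6); it is where η_SR = 2 − α_* lives (why it might fail: if the true crossover
sits at α = 2 with logarithms (BrezinParisiRiccitersenghi2014 scenario) the variational α_* is not 3
− 2Δ_SR and T is not the n.n. limit). #4 EndpointContinuity — the normalised LR limits converge
pointwise as α ↑ α_* to some T with T₂ > 0 and U₄(T) ≢ 0: BRRZ continuity of normalised CFT data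
across the crossover, LRFP → SRFP + decoupled χ, with 'correlation functions [having] a good power
series expansion in g' (BehanEtAl2017 §4.3.1) and g_*² ∝ α_* − α (why it might fail: contested in
physics until 2017 — AngeliniParisiRiccitersenghi2014, BrezinParisiRiccitersenghi2014,
LuijtenBlote2002; the IR normalisation of ⟨φφ⟩ vanishes linearly at the crossover (BehanEtAl2017 §8
p.24), so only NORMALISED data can be continuous — built in). #5 ProtectedWindow — ∃ a > 3/2 with
Prot on (3/2, a): two-sided c‖x‖^(−(3−α)) ≤ G_α(x) ≤ C‖x‖^(−(3−α)) just above the Gaussian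
threshold. The upper half is the infrared bound for reflection-positive couplings with k^(−1−α)
shell sums (Panis2023Triviality Prop. 3.8 / §3.6; PROVED in tree for the ℓ¹-family as
panis_infraredBound_algebraic_holds by a torus route that uses only RP + Gaussian domination + m*(β)
= 0 below β_c — to be re-run for J_α once its RP is filed); the content is the LOWER bound = Sak's η
= 2 − α as a pointwise law (LohmannSladeWallace2017 Thm 1.1 at small ε for weakly coupled |φ|⁴;
Hutchcroft2024 Thm 1.4 for LR percolation whenever α < 1, non-perturbatively). Most tractable entry
point (why it might fail: ±1 spins are strongly coupled; logarithmic factors are predicted exactly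
AT α = 3/2 (Panis2023Triviality Cor. 1.11) and AT α_* (BehanEtAl2017 §8: c(r) ∝ 1/log r) and must
not leak into the open window).
KILL CRITERIA. (a) LRWindowConformal refuted at one protected α (a scale- but not
inversion-covariant LR limit of the ISOTROPIC family, or a Gaussian one above 3/2) closes the route
(PRvRZ/FMN wrong for ±1 spins) — close --reason refuted:LRWindowConformal. (b) A proof that Prot
fails on every (3/2, 3/2+ε) (logs persisting above d_eff = 4) refutes ProtectedWindow — close. (c)
EndpointIsNearestNeighbour refuted (J_α for some α ∈ (α_*, 2] shown to have a normalised limit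
different from J_2's, or α_* shown ≠ 3 − 2Δ for an existing n.n. limit) kills the universality bet —
close; if instead the crossover is located at α = 2 (BPR scenario) the line pivots to 'endpoint α =
2 with logarithmic ρ', a different route. (d) EndpointContinuity refuted by a jump of normalised
four-point data at α_* — close (BRRZ wrong). (e) MOOT: if
IsingEuclidUpgrade/IsingCFTData/PerfectScreening close the conjunct first, close --reason
superseded.
NOT DECOMPOSED YET. (i) The small-ε anchor of #2 as a glued split LRWindowConformal ⇐ {tightness +
Prot-sharpness of subsequential limits of the J_α-correlators (Gaussian domination, regularity à la
AizenmanDuminilCopinAnnals2021 §5–6); uniqueness of the limit via the LR fixed point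
(BMS/Slade/Abdesselam at α = (3+ε)/2, then continuation in α); Möbius covariance of subsequential
limits from the Caffarelli–Silvestre extension (−Δ)^(α/2) = Dirichlet-to-Neumann map of ℝ⁴₊, on
which Möb(ℝ³) = Isom(ℍ⁴) acts, plus reflection positivity} — only after #5 is stamped. (ii) SUPPORT
FACTS foreseen, not filed (≤ 15 items; provers attach them with --supports): reflection positivity
of J_α w.r.t. coordinate planes (resolvent superposition above; FrohlichIsraelLiebSimon1978 §3), J_α
> 0 and J_α(x) ∼ c_α|x|^(−3−α) (Slade2017 Lemma 2.1.1), the infrared bound for J_α (transport of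
panis_infraredBound_algebraic_holds), J_2 = nnCoupling 3 and the identification of the critical free
state of J_2 with criticalCorr 3 (LongRangeIsing.criticalBeta J_2 = criticalBeta 3; free = + state
at β_c via m*(β_c(3)) = 0, AizenmanDuminilCopinSidoravicius2015), m*(β_c(α)) = 0 along the family
(needed only inside proofs). (iii) The card's λ-deformation J = n.n. + λ|x−y|^(−3−α) and (VAR)
λ-independence of α_* (Griffiths monotonicity) — a second route if #3 stalls. (iv) A
Hutchcroft-style hierarchical / non-perturbative skeleton for the lower bound in #5 (Hutchcroft2022
JMP; Hutchcroft2024) transposed to Ising via random currents. (v) Exponent bookkeeping 2Δ_SR = 3 −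
α_* vs HasIsingExponentEta 3 (2 − α_*) (isingScalingRelationHolds) — a support statement once #3
moves. CONE REPAIR 2026-08-15 (rev 2): every item now opens `open
Literature.Probability.LatticeModels in` and carries the same `let` header — J a x y :=
−((−Δ_ℤ³)^(a/2))_(x,y) as the Brillouin-zone integral ((2π)^3)⁻¹∫_{[−π,π]³}(2Σ_i(1−cos k_i))^(a/2)
cos(k·(x−y)) dk (x ≠ y; 0 on the diagonal), st a β h F := lim_L of the free finite-volume Gibbs
expectation on box 3 L (limUnder, junk if divergent — exactly LongRangeIsing.state), βc a := sInf{β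
> 0 : lim_{h↓0} st a β h σ₀ > 0} (= LongRangeIsing.criticalBeta), G a x := st a (βc a) 0 (σ₀σ_x) (=
LongRangeIsing.pairCorrelation … 0 x), corr a n y := st a (βc a) 0 (spinMonomial y), Prot b :=
two-sided c/‖x‖^(3−b) ≤ G b x ≤ C/‖x‖^(3−b) — VERBATIM UNFOLDINGS of LongRangePhi4.fracLaplacianZd /
LongRangeIsing.state / criticalBeta / pairCorrelation (planner folder Bridge.lean: new ↔ rev-1 decl
by Iff.rfl for all five items, lean check rc 0), so meaning, stamps' substance and the grounder's
candidate glue proofs (stmt-4465/4466) transfer by `Iff.rfl`/`show`; the route file therefore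
imports NOTHING outside the sub-problem Statement cone (the 31 unproved named facts of rev 1 rode in
on Literature.Barriers.CriticalPhenomena.LongRangeTrivialityOnZ3Inputs → …OnZ3 → Sweep1 →
InterfaceSLE/PlanarIsing/GibbsStates and on ….RigorousRGSmallParameter, the homes of those two
definitions; none of them was a hypothesis of any item). Provers bridge to the library API with
`show`/`simp only [LongRangeIsing.state, LongRangeIsing.expectIn, LongRangeIsing.pairGibbsWeight,
LongRangeIsing.pairHamiltonian, LongRangeIsing.criticalBeta, LongRangeIsing.magnetization,
LongRangePhi4.fracLaplacianZd, LongRangePhi4.laplaceSymbol, dispersion, brillouin]` in their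
Theorems files, which may import the barrier modules freely.
CHEAPEST FALSIFIER. Literature/numerics at the d = 2 analogue, where everything is sharper (α_*(2) =
7/4 exactly, η_SR = 1/4): AngeliniParisiRiccitersenghi2014 (doi:10.1103/physreve.89.062120) and
LuijtenBlote2002 (doi:10.1103/physrevlett.89.025703) measure LR exponents across the crossover — a
reproducible JUMP of normalised amplitude ratios / Binder cumulant limits at α_* kills #4; agreement
of Δ(α) with (d−α)/2 up to α_* without interior logarithms supports #5. In d = 3: MC of J_α =
−(−Δ)^(α/2) at α ∈ {1.6, 1.8, 1.9} (kit compute; Luijten–Blöte cluster algorithm, L ≤ 64): fit 2Δ(α)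
against 3 − α (predicted exact) and locate where it detaches (predicted 1.964); and ROTATION TEST of
the LR limit at α = 1.7 (ratio G_α(n,n,0)/G_α(⌊n√2⌋,0,0) → 1?) — failure of isotropy for the
fractional-Laplacian kernel would kill #2 outright. Lookup falsifier run this session: no printed
logarithmic correction to ⟨σ₀σ_x⟩ strictly inside (3/2, α_*) was found (logs are printed only AT
3/2, Panis2023Triviality Cor. 1.11, and AT α_*, BehanEtAl2017 §8).
NUMBERS. Δ_σ(3D Ising) = 0.5181489(10) (BehanEtAl2017 §3 p.14) ⇒ α_* = 3 − 2Δ_σ = 1.96370, η_SR =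
0.036298, window (1.5, 1.9637), ε = 2α − 3 ∈ (0, 0.927). Rigorous: any n.n. limit has Δ ∈ [1/2, 1]
(criticalTwoPoint_bounds); η ≤ 1/2 if it exists (DuminilcopinPanis2025 Thm 1.5) ⇔ α_* ≥ 3/2,
consistent with ProtectedWindow; Gaussian for RP couplings with α < 3/2 (Panis2023Triviality Thm 1.2
/ 5.5; formal barrier LongRangeTrivialityOnZ3_holds for the ℓ¹ family) and at α = 3/2 (Cor. 1.11,
not formalised).
SOURCES. Panis2023Triviality; Slade2017; LohmannSladeWallace2017; BrydgesMitterScoppola2003;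
Abdesselam2007; Abdesselam2018Towards (arXiv:1511.03180, Conj. 4–5, p.7–8); PaulosEtAl2016
(arXiv:1509.00008); BehanEtAl2017 (arXiv:1703.05325 §1.1, §4.3, §8); FisherMaNickel1972; Sak1973;
AizenmanFernandez1988; Hutchcroft2022; Hutchcroft2024 (arXiv:2404.07276 Thm 1.4); Hutchcroft2025
(arXiv:2508.18808 p.6, Cor. II.1.17, Rem. II.1.18); BrezinParisiRiccitersenghi2014;
AngeliniParisiRiccitersenghi2014; LuijtenBlote2002; DuminilcopinPanis2025; DuminilCopinICM2022 §8;
AizenmanDuminilCopinSidoravicius2015; FrohlichIsraelLiebSimon1978.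
DEFINITION REQUESTS. None filed. RECOMMENDED housekeeping (not load-bearing, not filed so as not to
gate serving): re-home LongRangeIsing.{pairHamiltonian, expectIn, state, magnetization,
criticalBeta, pairCorrelation} into a light Literature/Probability/LatticeModels module (imports
IsingModel + ThermodynamicLimit only) and LongRangePhi4.fracLaplacianZd into one importing only
Mathlib + LatticeGraph; the items can then be restated back to named form by a 1:1 Iff.rfl restate
without touching the cone.

Novelty: NOVELTY (search-before-claim, 2026-08-15; the card itself was audited new-combination by
refuter-novelty-audit-…-1-0 who read arXiv:1511.03180 pp.7–8 and arXiv:2508.18808 §II.1). Planner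
searches this session: `lit search … --source crossref` ("crossover long-range short-range Ising
critical exponents": doi:10.1007/s10955-014-1081-0 BPR2014, doi:10.1103/physrevlett.118.241601
BRRZ-PRL, doi:10.1103/physrevb.84.054433; "critical exponents long-range interactions Aizenman
Fernandez": doi:10.1007/bf00398169; "Panis long-range Ising": doi:10.1214/24-aihp1472
Gunaratnam–Panis (subcritical fractional-GFF correlations); "Duminil-Copin Panis lower bounds":
doi:10.1007/s00220-025-05236-2), `lit read` of arXiv:2508.18808 (pp.5–6, 17–18 incl. Remark II.1.18
on anisotropic kernels, bibliography [13],[51],[55],[70],[88]), arXiv:1703.05325 (pp.4, 17, 21, 24),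
arXiv:1511.03180 (pp.7–8), arXiv:2404.05700 (Thms 1.2–1.5: n.n. only), `lit frontier
CriticalPhenomena --since 2022` and `lit bridges --cross any` (planar/SLE descendants;
arXiv:2510.03951 the only LR item), `lit galaxy search "long-range to short-range crossover Ising"
--star all` (0 hits; service saturated), in-tree barrier files RigorousRGSmallParameter(+Proofs:
BRRZ window audit; fracLaplacianZd), LongRangeTrivialityOnZ3(+TwoPoint, +InfraredBoundHolds).
Nearest prior art FOUND: Abdesselam2018Towards Conj. 4 (Möbius covariance of the 3D BMS long-range
fixed point, [φ] = (3−ε)/4) and Conj. 5 (±1 lattice realisation with the fractiona  [refs: 10.1007/s10955-014-1081-0, 10.1103/physrevlett.118.241601, 10.1103/physrevb.84.054433, 10.1007/bf00398169, 10.1214/24-aihp1472, 10.1007/s00220-025-05236-2, 1511.03180, 2508.18808, 1703.05325, 2404.05700, 2510.03951, doi:10.1007/s10955-014-1081-0, doi:10.1103/physrevlett.118.241601, doi:10.1103/physrevb.84.054433, doi:10.1007/bf00398169, doi:10.1214/24-aihp1472, doi:10.1007/s00220-025-05236-2, Paul]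

Barriers (technique_class: long-range-continuation, crossover-endpoint): - technique_class: long-range-continuation, crossover-endpoint
- Literature.Barriers.CriticalPhenomena.RigorousRGSmallParameter: APPLIES squarely to crux #2 beyond
small ε and is NOT evaded there — the window (3/2 + ε₀/2, α_*) has no constructive-RG control
('which Banach space …'); the bet is that #2 needs the fixed point only through exponent identities
(Prot, protected Δ) and covariance of (sub)sequential limits (extension structure + RP), never as a
point of a Banach space; the barrier's own audit
(LongRangePhi4.epsilonRegime_three_meets_window_iff) records that what separates Slade's regime —
for the SAME lattice operator fracLaplacianZd — from the target is the unprinted size of ε₀ against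
1 − 2η_SR ≈ 0.927, i.e. exactly this route's parameter.
- Literature.Barriers.CriticalPhenomena.RigorousRGSmallParameterNarrow: same; the hierarchical
no-small-parameter constructions (Koch–Wittwer) it lists as outside the class are the natural engine
for a computer-assisted attack on #2/#5 at fixed α ∈ (1.6, 1.9), not used yet.
- Literature.Barriers.CriticalPhenomena.LongRangeTrivialityOnZ3: CONSISTENT — every crux quantifies
over α > 3/2 only (effective dimension < 4), so nothing interaction-uniform is claimed; the formal
barrier is for the ℓ¹ family, Panis's Thm 1.2/5.5 covers all (A1)–(A5) RP interactions including
J_α, α < 3/2 (anchor: Gaussian below the window).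
- Literature.Barriers.CriticalPhenomena.IsingTrivialityFromDimensionFour: evaded — nothing is
dimension-uniform: the d

History (route lifecycle, newest last):
- 2026-08-15T16:55:49Z · rev 2: restated EndpointThesis (stmt-CriticalPhenomena-4460), LRWindowConformal (stmt-CriticalPhenomena-4461), EndpointIsNearestNeighbour (stmt-CriticalPhenomena-4462), EndpointContinuity (stmt-CriticalPhenomena-4463), ProtectedWindow (stmt-CriticalPhenomena-4464) — cone repair (route-repair planner, 2026-08-15): REROU (planner-rrepair-CriticalPhenomena-LongRangeEnd-7e2601a1-g2-0)
- 2026-08-16T03:55:57Z · AUTO-CRUX (backfill): EndpointThesis — hypotheses of the deciding theorem that nothing in the route derives are cruxes (operator:999:1085951)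
- 2026-08-22T11:18:45Z · DORMANT — reconciler: no traction for 5.3 d (last activity item-evidence-added at 2026-08-17T03:45:10Z); parked, not closed — `ledger route dormant route-CriticalPhenomen (operator:999:2237615)

sub-problem: Ising3DConformalLimit · status: dormant · opened planner-plancard-CriticalPhenomena-Ising3DCon-3f369dee-0 2026-08-15T11:34:17Z · rev 5 · ledger route-CriticalPhenomena-LongRangeEndpoint
GENERATED by the gate from the ledger (D-0016/17). Provers cite these decls: `theorem foo : Summit.CriticalPhenomena.Ising3DConformalLimit.Theses.LongRangeEndpoint.<Decl> := …` in Summits/CriticalPhenomena/Ising3DConformalLimit/Theorems/<Name>.lean.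
-/

namespace Summit.CriticalPhenomena.Ising3DConformalLimit.Theses.LongRangeEndpoint

open scoped BigOperators Topology Manifold Classical MeasureTheory ProbabilityTheory Matrix InnerProductSpace ComplexConjugate ContinuousMap
open Filter Set Function TopologicalSpace MeasureTheory

attribute [summit_statement] _root_.Ising3DConformalLimit

-- earlier EndpointThesis (stmt-CriticalPhenomena-4460, replaced 2026-08-15T16:55:49Z -> stmt-CriticalPhenomena-11271): retired by None — ∃ αs ∈ Set.Ioc (3 / 2 : ℝ) 2, ∃ (S : ℝ → Literature.Probability.LatticeModels.CorrFamily 3) (T : Literature.Probability.LatticeModels.CorrFamily 3), (∀ a ∈ Set.Ioo (3 / 2 : ℝ) αs, (∃ ρ : ℝ → ℝ, (∀ δ ∈ Set.Ioc (0 : ℝ) 1, 0 < ρ δ) ∧ Literature.Probability.LatticeMode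
/-- item stmt-CriticalPhenomena-11271 · crux (kind.auto-crux: conjecture-grade) · rank 0 · open · by planner
why it might fail: Conjunction of r2–r5: LR conformal window beyond small ε (Abdesselam Conj. 4–5), BRRZ continuity at α_*, full n.n. scaling limit + Sak universality at the endpoint ('out of reach even for d=2', Hutchcroft2025 p.6); fails if the crossover sits at α=2 (FisherMaNickel1972, Picco 2012): α_*=2, Δ=1/2.
sources: Abdesselam2018Towards, BehanEtAl2017, Hutchcroft2025, PaulosEtAl2016, Sak1973, FisherMaNickel1972
[cone repair 2026-08-15, rev 2 — restated 1:1 as the VERBATIM UNFOLDING of the rev-1 decl (Iff.rfl,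
planner Bridge.lean rc 0): the shared `let` header J/st/βc/G/corr/Prot spells out
LongRangePhi4.fracLaplacianZd and LongRangeIsing.state/criticalBeta/pairCorrelation over
Statement-cone primitives so the route file needs no Literature.Barriers import; supersedes
stmt-CriticalPhenomena-4460] [target] X: ∃ α_* ∈ (3/2, 2], a family S : ℝ → CorrFamily 3 and T such
that for every α ∈ (3/2, α_*) S α is a pointwise scaling limit (some ρ > 0 on (0,1]) of the critical
correlators n, y ↦ ⟨∏σ_(y_i)⟩ of J_α(x,y) = −((−Δ_ℤ³)^(α/2))_(x,y) (x ≠ y;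
LongRangePhi4.fracLaplacianZd 3 (α/2); J_2 = n.n.) at LongRangeIsing.criticalBeta (free b.c., h = 0)
and is Möbius covariant with Δ(α) = (3−α)/2; S α n z → T n z as α ↑ α_* for every n and EVERY
configuration z; T is a pointwise scaling limit of criticalCorr 3 (n.n., + state, β_c(3)) for some ρ
> 0; T₂ > 0 off the diagonal; U₄(T) ≢ 0. X → Ising3DConformalLimit = ThesisSuffices (closedness;
proved in Sketch.lean). Card: long-range-crossover-endpoint (L1)+(L2)+(L3). -/
@[route_item "route-CriticalPhenomena-LongRangeEndpoint", crux]
def EndpointThesis : Prop :=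
  open Literature.Probability.LatticeModels in let J : ℝ → Site 3 → Site 3 → ℝ := fun a x y => if x = y then (0 : ℝ) else -(((2 * Real.pi) ^ 3)⁻¹ * ∫ k in Set.pi Set.univ (fun _ : Fin 3 => Set.Icc (-Real.pi) Real.pi), (2 * ∑ i, (1 - Real.cos (k i))) ^ (a / 2) * Real.cos (∑ j, k j * ((x j : ℝ) - (y j : ℝ)))); let st : ℝ → ℝ → ℝ → (SpinConfig (Site 3) → ℝ) → ℝ := fun a β h F => limUnder atTop (fun L : ℕ => let Λ := box 3 L; let w : (↥Λ → ℤˣ) → ℝ := fun τ => Real.exp (-β * (-(∑ x ∈ Λ, ∑ y ∈ Λ, J a x y * spinAt x (glue Λ τ .free) * spinAt y (glue Λ τ .free)) / 2 - h * ∑ x ∈ Λ, spinAt x (glue Λ τ .free))); (∑ τ, F (glue Λ τ .free) * w τ) / ∑ τ, w τ); let βc : ℝ → ℝ := fun a => sInf {β : ℝ | 0 < β ∧ 0 < limUnder (𝓝[>] (0 : ℝ)) (fun h : ℝ => st a β h (spinAt 0))}; let corr : ℝ → (n : ℕ) → (Fin n → Site 3) → ℝ := fun a _ y => st a (βc a)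 0 (spinMonomial y); ∃ αs ∈ Set.Ioc (3 / 2 : ℝ) 2, ∃ (S : ℝ → CorrFamily 3) (T : CorrFamily 3), (∀ a ∈ Set.Ioo (3 / 2 : ℝ) αs, (∃ ρ : ℝ → ℝ, (∀ δ ∈ Set.Ioc (0 : ℝ) 1, 0 < ρ δ) ∧ HasPointwiseScalingLimit (corr a) ρ (S a)) ∧ IsMoebiusCovariant ((3 - a) / 2) (S a)) ∧ (∀ (n : ℕ) (z : Fin n → EuclideanSpace ℝ (Fin 3)), Filter.Tendsto (fun a : ℝ => S a n z) (𝓝[<] αs) (𝓝 (T n z))) ∧ (∃ ρ : ℝ → ℝ, (∀ δ ∈ Set.Ioc (0 : ℝ) 1, 0 < ρ δ) ∧ HasPointwiseScalingLimit (criticalCorr 3) ρ T) ∧ IsNondegenerateTwoPoint T ∧ HasNontrivialU4 T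

-- earlier LRWindowConformal (stmt-CriticalPhenomena-4461, replaced 2026-08-15T16:55:49Z -> stmt-CriticalPhenomena-11272): retired by None — ∀ a : ℝ, 3 / 2 < a → a < 2 → (∃ c C : ℝ, 0 < c ∧ ∀ x : Literature.Probability.LatticeModels.Site 3, x ≠ 0 → c / ‖x‖ ^ ((3 : ℝ) - a) ≤ Literature.Barriers.CriticalPhenomena.LongRangeIsing.pairCorrelation (fun x y : Literature.Probability.LatticeModels.Site 3 => i
/-- item stmt-CriticalPhenomena-11272 · crux · rank 2 · open · by planner
why it might fail: No construction of a non-Gaussian LR scaling limit for ±1 spins at ANY α (Abdesselam Conj. 5(2) 'even more difficult'; rigorous RG = weak coupling, small ε); full δ→0 limit = uniqueness, no engine; Möbius w/o stress tensor only to all orders (PRvRZ): a scale- but not inversion-covariant limit open.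
sources: Abdesselam2018Towards, PaulosEtAl2016, BehanEtAl2017, Slade2017, LohmannSladeWallace2017, BrydgesMitterScoppola2003
[cone repair 2026-08-15, rev 2 — restated 1:1 as the VERBATIM UNFOLDING of the rev-1 decl (Iff.rfl,
planner Bridge.lean rc 0): the shared `let` header J/st/βc/G/corr/Prot spells out
LongRangePhi4.fracLaplacianZd and LongRangeIsing.state/criticalBeta/pairCorrelation over
Statement-cone primitives so the route file needs no Literature.Barriers import; supersedes
stmt-CriticalPhenomena-4461] [crux] r2 (card (L1), 'protected law ⇒ conformal non-Gaussian limit'):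
for every 3/2 < α < 2, IF the critical two-point function of J_α(x,y) = −((−Δ_ℤ³)^(α/2))_(x,y) (x ≠
y; LongRangePhi4.fracLaplacianZd 3 (α/2); J_2 = n.n.) (LongRangeIsing.pairCorrelation at
LongRangeIsing.criticalBeta, free b.c.) obeys c/‖x‖^(3−α) ≤ G_α(x) ≤ C/‖x‖^(3−α) for x ≠ 0, THEN the
critical n-point correlators ⟨∏σ_(y_i)⟩ (LongRangeIsing.state … (spinMonomial y)) have a pointwise
scaling limit S (HasPointwiseScalingLimit, some ρ > 0 on (0,1]) which is Möbius covariant with Δ =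
(3−α)/2 (IsMoebiusCovariant), non-degenerate, with U₄ ≢ 0, normalised by S 2 (0,e₁) = 1 and S = 0 on
coincident configurations (conventions: any witness (ρ,S) yields one via κ := S₂(0,e₁)^(−1/2), ρ ↦
κρ, S ↦ κⁿS·𝟙_NonCoincident; rescaledCorrelator s -/
@[route_item "route-CriticalPhenomena-LongRangeEndpoint", crux]
def LRWindowConformal : Prop :=
  open Literature.Probability.LatticeModels in let J : ℝ → Site 3 → Site 3 → ℝ := fun a x y => if x = y then (0 : ℝ) else -(((2 * Real.pi) ^ 3)⁻¹ * ∫ k in Set.pi Set.univ (fun _ : Fin 3 => Set.Icc (-Real.pi) Real.pi), (2 * ∑ i, (1 - Real.cos (k i))) ^ (a / 2) * Real.cos (∑ j, k j * ((x j : ℝ) - (y j : ℝ)))); let st : ℝ → ℝ → ℝ → (SpinConfig (Site 3) → ℝ) → ℝ := fun a β h F => limUnder atTop (fun L : ℕ => let Λ := box 3 L; let w : (↥Λ → ℤˣ) → ℝ := fun τ => Real.exp (-β * (-(∑ x ∈ Λ, ∑ y ∈ Λ, J a x y * spinAt x (glue Λ τ .free) * spinAt y (glue Λ τ .free)) / 2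 - h * ∑ x ∈ Λ, spinAt x (glue Λ τ .free))); (∑ τ, F (glue Λ τ .free) * w τ) / ∑ τ, w τ); let βc : ℝ → ℝ := fun a => sInf {β : ℝ | 0 < β ∧ 0 < limUnder (𝓝[>] (0 : ℝ)) (fun h : ℝ => st a β h (spinAt 0))}; let G : ℝ → Site 3 → ℝ := fun a x => st a (βc a) 0 (fun σ => spinAt 0 σ * spinAt x σ); let corr : ℝ → (n : ℕ) → (Fin n → Site 3) → ℝ := fun a _ y => st a (βc a) 0 (spinMonomial y); ∀ a : ℝ, 3 / 2 < a → a < 2 → (∃ c C : ℝ, 0 < c ∧ ∀ x : Site 3, x ≠ 0 → c / ‖x‖ ^ ((3 : ℝ) - a) ≤ G a x ∧ G a x ≤ C / ‖x‖ ^ ((3 : ℝ) - a)) → ∃ (ρ : ℝ → ℝ) (S : CorrFamily 3), (∀ δ ∈ Set.Ioc (0 : ℝ) 1, 0 < ρ δ) ∧ HasPointwiseScalingLimit (corr a) ρ S ∧ IsMoebiusCovariant ((3 - a) / 2) S ∧ IsNondegenerateTwoPoint S ∧ HasNontrivialU4 S ∧ S 2 ![0, (EuclideanSpace.single (0 : Fin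 3) (1 : ℝ))] = 1 ∧ (∀ (n : ℕ) (z : Fin n → EuclideanSpace ℝ (Fin 3)), z ∉ NonCoincident 3 n → S n z = 0)

-- earlier EndpointIsNearestNeighbour (stmt-CriticalPhenomena-4462, replaced 2026-08-15T16:55:49Z -> stmt-CriticalPhenomena-11273): retired by None — ∀ αs : ℝ, IsLUB {a : ℝ | a ≤ 2 ∧ ∀ b ∈ Set.Ioo (3 / 2 : ℝ) a, (∃ c C : ℝ, 0 < c ∧ ∀ x : Literature.Probability.LatticeModels.Site 3, x ≠ 0 → c / ‖x‖ ^ ((3 : ℝ) - b) ≤ Literature.Barriers.CriticalPhenomena.LongRangeIsing.pairCorrelation (fun x y : Litera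
/-- item stmt-CriticalPhenomena-11273 · crux · rank 3 · open · by planner
why it might fail: Needs the FULL n.n. scaling limit on ℤ³ (open, DuminilCopinICM2022 §8.4) AND Sak's α_*=2−η_SR as a theorem ('out of reach even for d=2', Hutchcroft2025 p.6); false if the crossover sits at α=2 (FisherMaNickel1972; Picco arXiv:1207.1018, no cusp in MC): then α_*=2 and T would force Δ=1/2, η_SR=0.
sources: Hutchcroft2025, DuminilCopinICM2022, Sak1973, FisherMaNickel1972, arXiv:1207.1018, doi:10.1209/0295-5075/101/56003
[cone repair 2026-08-15, rev 2 — restated 1:1 as the VERBATIM UNFOLDING of the rev-1 decl (Iff.rfl,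
planner Bridge.lean rc 0): the shared `let` header J/st/βc/G/corr/Prot spells out
LongRangePhi4.fracLaplacianZd and LongRangeIsing.state/criticalBeta/pairCorrelation over
Statement-cone primitives so the route file needs no Literature.Barriers import; supersedes
stmt-CriticalPhenomena-4462] [crux] r3 (card (L3), short-range universality at the endpoint): for
every αs which is the least upper bound of {a ≤ 2 | ∀ b ∈ (3/2, a), Prot(b)} (Prot as in r2; the set
is non-empty and bounded by 2, so αs = its sSup = the variational crossover exponent α_*) with 3/2 <
αs: for EVERY family S : ℝ → CorrFamily 3 such that for all α ∈ (3/2, αs) S α is a pointwise scaling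
limit of the critical correlators of J_α(x,y) = −((−Δ_ℤ³)^(α/2))_(x,y) (x ≠ y;
LongRangePhi4.fracLaplacianZd 3 (α/2); J_2 = n.n.) (some ρ > 0), normalised S α 2 (0,e₁) = 1 and S α
= 0 off NonCoincident (this pins S α uniquely: limits are unique up to κⁿ), and for every T with S α
n z → T n z (α ↑ αs, all n, z): T is a pointwise scaling limit of the nearest-neighbour critical
correlators criticalCorr 3 (+ state at criticalBeta 3) for -/
@[route_item "route-CriticalPhenomena-LongRangeEndpoint", crux]
def EndpointIsNearestNeighbour : Prop :=
  open Literature.Probability.LatticeModels in let J : ℝ → Site 3 → Site 3 → ℝ := fun a x y => if x = y then (0 : ℝ) else -(((2 * Real.pi) ^ 3)⁻¹ * ∫ k in Set.pi Set.univ (fun _ : Fin 3 => Set.Icc (-Real.pi) Real.pi), (2 * ∑ i, (1 - Real.cos (k i))) ^ (a / 2) * Real.cos (∑ j, k j * ((x j : ℝ) - (y j : ℝ)))); let st : ℝ → ℝ → ℝ → (SpinConfig (Site 3) → ℝ) → ℝ := fun a β h F => limUnder atTop (fun L : ℕ => let Λ := box 3 L; let w : (↥Λ → ℤˣ) → ℝ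 := fun τ => Real.exp (-β * (-(∑ x ∈ Λ, ∑ y ∈ Λ, J a x y * spinAt x (glue Λ τ .free) * spinAt y (glue Λ τ .free)) / 2 - h * ∑ x ∈ Λ, spinAt x (glue Λ τ .free))); (∑ τ, F (glue Λ τ .free) * w τ) / ∑ τ, w τ); let βc : ℝ → ℝ := fun a => sInf {β : ℝ | 0 < β ∧ 0 < limUnder (𝓝[>] (0 : ℝ)) (fun h : ℝ => st a β h (spinAt 0))}; let G : ℝ → Site 3 → ℝ := fun a x => st a (βc a) 0 (fun σ => spinAt 0 σ * spinAt x σ); let corr : ℝ → (n : ℕ) → (Fin n → Site 3) → ℝ := fun a _ y => st a (βc a) 0 (spinMonomial y); let Prot : ℝ → Prop := fun b => ∃ c C : ℝ, 0 < c ∧ ∀ x : Site 3, x ≠ 0 → c / ‖x‖ ^ ((3 : ℝ) - b) ≤ G b x ∧ G b x ≤ C / ‖x‖ ^ ((3 : ℝ) - b); ∀ αs : ℝ, IsLUB {a : ℝ | a ≤ 2 ∧ ∀ b ∈ Set.Ioo (3 / 2 : ℝ) a, Prot b} αs → 3 / 2 < αs → ∀ (S : ℝ → CorrFamily 3) (T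 : CorrFamily 3), (∀ a ∈ Set.Ioo (3 / 2 : ℝ) αs, (∃ ρ : ℝ → ℝ, (∀ δ ∈ Set.Ioc (0 : ℝ) 1, 0 < ρ δ) ∧ HasPointwiseScalingLimit (corr a) ρ (S a)) ∧ S a 2 ![0, (EuclideanSpace.single (0 : Fin 3) (1 : ℝ))] = 1 ∧ (∀ (n : ℕ) (z : Fin n → EuclideanSpace ℝ (Fin 3)), z ∉ NonCoincident 3 n → S a n z = 0)) → (∀ (n : ℕ) (z : Fin n → EuclideanSpace ℝ (Fin 3)), Filter.Tendsto (fun a : ℝ => S a n z) (𝓝[<] αs) (𝓝 (T n z))) → ∃ ρ : ℝ → ℝ, (∀ δ ∈ Set.Ioc (0 : ℝ) 1, 0 < ρ δ) ∧ HasPointwiseScalingLimit (criticalCorr 3) ρ T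

-- earlier EndpointContinuity (stmt-CriticalPhenomena-4463, replaced 2026-08-15T16:55:49Z -> stmt-CriticalPhenomena-11274): retired by None — ∀ αs : ℝ, IsLUB {a : ℝ | a ≤ 2 ∧ ∀ b ∈ Set.Ioo (3 / 2 : ℝ) a, (∃ c C : ℝ, 0 < c ∧ ∀ x : Literature.Probability.LatticeModels.Site 3, x ≠ 0 → c / ‖x‖ ^ ((3 : ℝ) - b) ≤ Literature.Barriers.CriticalPhenomena.LongRangeIsing.pairCorrelation (fun x y : Literature.Pro
/-- item stmt-CriticalPhenomena-11274 · crux · rank 4 · open · by planner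
why it might fail: BRRZ continuity (LRFP→SRFP+χ, corrections O(g_*²)∝α_*−α) is conformal perturbation theory, no theorem; a left limit needs normalised LRFP data analytic in g_*² while the ⟨φφ⟩ amplitude vanishes linearly, c(r)∝1/log r at s_* (BRRZ §8, BPR2014); MC saw smooth η (Picco); U₄(T)≢0: non-Gaussian end.
sources: BehanEtAl2017, PaulosEtAl2016, BrezinParisiRiccitersenghi2014, AngeliniParisiRiccitersenghi2014, LuijtenBlote2002, arXiv:1207.1018
[cone repair 2026-08-15, rev 2 — restated 1:1 as the VERBATIM UNFOLDING of the rev-1 decl (Iff.rfl,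
planner Bridge.lean rc 0): the shared `let` header J/st/βc/G/corr/Prot spells out
LongRangePhi4.fracLaplacianZd and LongRangeIsing.state/criticalBeta/pairCorrelation over
Statement-cone primitives so the route file needs no Literature.Barriers import; supersedes
stmt-CriticalPhenomena-4463] [crux] r4 (card (L2), continuity at the crossover): with αs = the least
upper bound of the protected-window set (as in r3) and 3/2 < αs, every normalised family S of
pointwise scaling limits of the critical correlators of J_α(x,y) = −((−Δ_ℤ³)^(α/2))_(x,y) (x ≠ y;
LongRangePhi4.fracLaplacianZd 3 (α/2); J_2 = n.n.) on the window (3/2, αs) (normalisation S α 2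
(0,e₁) = 1, S α = 0 off NonCoincident) converges pointwise as α ↑ αs — for every n and every
configuration — to some T with T₂ > 0 off the diagonal and U₄(T) ≢ 0 (IsNondegenerateTwoPoint,
HasNontrivialU4). Physics: BRRZ — the LR fixed point crosses over CONTINUOUSLY at s_* = 2 − η to
SRFP + decoupled Gaussian χ ('Like in the standard picture, the crossover in our picture does happen
continuously and at s = s_*', BehanEtAl2017 §1.1 p.4); near s_ -/
@[route_item "route-CriticalPhenomena-LongRangeEndpoint", crux]
def EndpointContinuity : Prop :=
  open Literature.Probability.LatticeModels in let J : ℝ → Site 3 → Site 3 → ℝ := fun a x y => if x = y then (0 : ℝ) else -(((2 * Real.pi) ^ 3)⁻¹ * ∫ k in Set.pi Set.univ (fun _ : Fin 3 => Set.Icc (-Real.pi) Real.pi), (2 * ∑ i, (1 - Real.cos (k i))) ^ (a / 2) * Real.cos (∑ j, k j * ((x j : ℝ) - (y j : ℝ)))); let st : ℝ → ℝ → ℝ → (SpinConfig (Site 3) → ℝ) → ℝ := fun a β h F => limUnder atTop (fun L : ℕ => let Λ := box 3 L; let w : (↥Λ → ℤˣ) → ℝ := fun τ => Real.exp (-β *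 (-(∑ x ∈ Λ, ∑ y ∈ Λ, J a x y * spinAt x (glue Λ τ .free) * spinAt y (glue Λ τ .free)) / 2 - h * ∑ x ∈ Λ, spinAt x (glue Λ τ .free))); (∑ τ, F (glue Λ τ .free) * w τ) / ∑ τ, w τ); let βc : ℝ → ℝ := fun a => sInf {β : ℝ | 0 < β ∧ 0 < limUnder (𝓝[>] (0 : ℝ)) (fun h : ℝ => st a β h (spinAt 0))}; let G : ℝ → Site 3 → ℝ := fun a x => st a (βc a) 0 (fun σ => spinAt 0 σ * spinAt x σ); let corr : ℝ → (n : ℕ) → (Fin n → Site 3) → ℝ := fun a _ y => st a (βc a) 0 (spinMonomial y); let Prot : ℝ → Prop := fun b => ∃ c C : ℝ, 0 < c ∧ ∀ x : Site 3, x ≠ 0 → c / ‖x‖ ^ ((3 : ℝ) - b) ≤ G b x ∧ G b x ≤ C / ‖x‖ ^ ((3 : ℝ) - b); ∀ αs : ℝ, IsLUB {a : ℝ | a ≤ 2 ∧ ∀ b ∈ Set.Ioo (3 / 2 : ℝ) a, Prot b} αs → 3 / 2 < αs → ∀ S : ℝ → CorrFamily 3, (∀ a ∈ Set.Ioo (3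 / 2 : ℝ) αs, (∃ ρ : ℝ → ℝ, (∀ δ ∈ Set.Ioc (0 : ℝ) 1, 0 < ρ δ) ∧ HasPointwiseScalingLimit (corr a) ρ (S a)) ∧ S a 2 ![0, (EuclideanSpace.single (0 : Fin 3) (1 : ℝ))] = 1 ∧ (∀ (n : ℕ) (z : Fin n → EuclideanSpace ℝ (Fin 3)), z ∉ NonCoincident 3 n → S a n z = 0)) → ∃ T : CorrFamily 3, (∀ (n : ℕ) (z : Fin n → EuclideanSpace ℝ (Fin 3)), Filter.Tendsto (fun a : ℝ => S a n z) (𝓝[<] αs) (𝓝 (T n z))) ∧ IsNondegenerateTwoPoint T ∧ HasNontrivialU4 T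

-- earlier ProtectedWindow (stmt-CriticalPhenomena-4464, replaced 2026-08-15T16:55:49Z -> stmt-CriticalPhenomena-11275): retired by None — ∃ a : ℝ, 3 / 2 < a ∧ ∀ b ∈ Set.Ioo (3 / 2 : ℝ) a, (∃ c C : ℝ, 0 < c ∧ ∀ x : Literature.Probability.LatticeModels.Site 3, x ≠ 0 → c / ‖x‖ ^ ((3 : ℝ) - b) ≤ Literature.Barriers.CriticalPhenomena.LongRangeIsing.pairCorrelation (fun x y : Literature.Probability.Lattic
/-- item stmt-CriticalPhenomena-11275 · crux · rank 5 · open · by planner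
why it might fail: Upper half = RP infrared bound (routine once RP of J_α is filed); LOWER bound η(α)≤2−α pointwise for ±1 spins unproved at every α>3/2 (rigorous only: weakly coupled |φ|⁴, LSW2017 Thm 1.6.1; LR percolation α<1, Hutchcroft2024 Thm 1.4); fails if strongly coupled spins leave the BMS basin above d_eff=4
sources: LohmannSladeWallace2017, Hutchcroft2024, Hutchcroft2022, Panis2023Triviality, Abdesselam2018Towards, AizenmanFernandez1988
[cone repair 2026-08-15, rev 2 — restated 1:1 as the VERBATIM UNFOLDING of the rev-1 decl (Iff.rfl,
planner Bridge.lean rc 0): the shared `let` header J/st/βc/G/corr/Prot spells out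
LongRangePhi4.fracLaplacianZd and LongRangeIsing.state/criticalBeta/pairCorrelation over
Statement-cone primitives so the route file needs no Literature.Barriers import; supersedes
stmt-CriticalPhenomena-4464] [crux] r5 (card (PROT), the protected regime is a non-empty initial
window): ∃ a > 3/2 such that for every α ∈ (3/2, a) there are c > 0, C with c/‖x‖^(3−α) ≤ ⟨σ₀σ_x⟩ ≤
C/‖x‖^(3−α) for all x ≠ 0 (sup norm on ℤ³) for the critical free-b.c. state of J_α(x,y) =
−((−Δ_ℤ³)^(α/2))_(x,y) (x ≠ y; LongRangePhi4.fracLaplacianZd 3 (α/2); J_2 = n.n.)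
(LongRangeIsing.pairCorrelation at LongRangeIsing.criticalBeta). Upper half = the infrared bound for
reflection-positive couplings whose shell sums are ≍ k^(−1−α) (Panis2023Triviality §3.6 / Prop. 3.8;
in tree PROVED for the ℓ¹-power family as
Literature.Barriers.CriticalPhenomena.panis_infraredBound_algebraic_holds by a torus route using
only RP, Gaussian domination and m* = 0 below β_c — re-run it for J_α once RP of J_α is filed as a
--supports lemma: −((−Δ+m²)^ -/
@[route_item "route-CriticalPhenomena-LongRangeEndpoint", crux]
def ProtectedWindow : Prop :=
  open Literature.Probability.LatticeModels in let J : ℝ → Site 3 → Site 3 → ℝ := fun a x y => if x = y then (0 : ℝ) else -(((2 * Real.pi) ^ 3)⁻¹ * ∫ k in Set.pi Set.univ (fun _ : Fin 3 => Set.Icc (-Real.pi) Real.pi), (2 * ∑ i, (1 - Real.cos (k i))) ^ (a / 2) * Real.cos (∑ j, k j * ((x j : ℝ) - (y j : ℝ)))); let st : ℝ → ℝ → ℝ → (SpinConfig (Site 3) → ℝ) → ℝ := fun a β h F => limUnder atTop (fun L : ℕ => let Λ := box 3 L; let w : (↥Λ → ℤˣ) → ℝ := fun τ => Real.exp (-β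 * (-(∑ x ∈ Λ, ∑ y ∈ Λ, J a x y * spinAt x (glue Λ τ .free) * spinAt y (glue Λ τ .free)) / 2 - h * ∑ x ∈ Λ, spinAt x (glue Λ τ .free))); (∑ τ, F (glue Λ τ .free) * w τ) / ∑ τ, w τ); let βc : ℝ → ℝ := fun a => sInf {β : ℝ | 0 < β ∧ 0 < limUnder (𝓝[>] (0 : ℝ)) (fun h : ℝ => st a β h (spinAt 0))}; let G : ℝ → Site 3 → ℝ := fun a x => st a (βc a) 0 (fun σ => spinAt 0 σ * spinAt x σ); let Prot : ℝ → Prop := fun b => ∃ c C : ℝ, 0 < c ∧ ∀ x : Site 3, x ≠ 0 → c / ‖x‖ ^ ((3 : ℝ) - b) ≤ G b x ∧ G b x ≤ C / ‖x‖ ^ ((3 : ℝ) - b); ∃ a : ℝ, 3 / 2 < a ∧ ∀ b ∈ Set.Ioo (3 / 2 : ℝ) a, Prot b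

/-- item stmt-CriticalPhenomena-14155 · support · rank 9 · open · by planner
[support, provable-now] GLUE Crux… → target (route-choice repair 2026-08-16, clears
`route.target-unreachable: no item concludes the target EndpointThesis`): the four ranked cruxes
reach X = EndpointThesis. Proof (pure logic + sSup bookkeeping on ℝ): from ProtectedWindow get a₀ >
3/2 with Prot on (3/2, a₀); P := {a ≤ 2 | Prot on (3/2, a)} ∋ min a₀ 2 and is bounded by 2, so α_*
:= sSup P has IsLUB P α_* (isLUB_csSup), 3/2 < α_* ≤ 2 (le_csSup / csSup_le) and Prot on (3/2, α_*)
(exists_lt_of_lt_csSup); `choose` the normalised Möbius-covariant family S from LRWindowConformal on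
the window (junk 0 outside — never read); EndpointContinuity (αs := α_*) yields T (pointwise limit
along 𝓝[<] α_*, T₂ > 0, U₄ ≢ 0); EndpointIsNearestNeighbour yields ρ > 0 with T a pointwise scaling
limit of criticalCorr 3; take αs := α_*. PROVED in the planner's Sketch.lean (theorem
RepairSketch.cruxesReachTarget_proof over Iff.rfl bridges to the let-headed items; lean check rc 0,
axioms propext / Classical.choice / Quot.sound; file attached as evidence on this item) — a prover
copies it into Theorems/CruxesReachTarget.lean. With ThesisSuffices (EndpointThesis →
Ising3DConformalLimit) the deciding theorem runs -/
@[route_item "route-CriticalPhenomena-LongRangeEndpoint", crux]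
def CruxesReachTarget : Prop :=
  LRWindowConformal → ProtectedWindow → EndpointContinuity → EndpointIsNearestNeighbour → EndpointThesis

/-- item stmt-CriticalPhenomena-4465 · support · rank 9 · open · by planner
sources: FrancescoMathieuSenechal1997 §4.3.1, planner Sketch.lean thesisSuffices_proof
[support, provable-now] EndpointThesis → Ising3DConformalLimit: closedness of Möbius covariance
under pointwise limits in the parameter. Take ρ, T from X, Δ := (3 − α_*)/2 > 0 (α_* ≤ 2); each
generator identity for S α (translation, O(3), dilation factor c^(−nΔ(α)), inversion factor
∏‖z_i‖^(2Δ(α))) passes to the limit along 𝓝[<] α_* by tendsto_nhds_unique, using Ioo_mem_nhdsLT,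
continuity of a ↦ c^(−n(3−a)/2) (Continuous.rpow) and of a ↦ ∏‖z_i‖^(3−a). PROVED in the planner's
Sketch.lean (theorem thesisSuffices_proof, 30 lines; evidence attached) — a prover copies it into
Theorems/. [difficulty: provable-now] -/
@[route_item "route-CriticalPhenomena-LongRangeEndpoint", crux]
def ThesisSuffices : Prop :=
  EndpointThesis → Ising3DConformalLimit

/-- item stmt-CriticalPhenomena-4466 · assembly · rank 1 · open · by planner
sources: planner Sketch.lean assembly_proof
[assembly, provable-now] LRWindowConformal → ProtectedWindow → EndpointContinuity →
EndpointIsNearestNeighbour → Ising3DConformalLimit. Glue (PROVED in the planner's Sketch.lean,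
theorem assembly_proof, 40 lines, axioms propext/Classical.choice/Quot.sound; evidence attached):
from ProtectedWindow get a₀ > 3/2 with Prot on (3/2, a₀); min a₀ 2 lies in the set P := {a ≤ 2 |
Prot on (3/2,a)}, which is bounded by 2, so α_* := sSup P satisfies IsLUB P α_* (isLUB_csSup), 3/2 <
α_* ≤ 2 (le_csSup / csSup_le) and Prot holds on (3/2, α_*) (exists_lt_of_lt_csSup); for each α in
the window LRWindowConformal (with α < 2) gives a normalised Möbius-covariant limit — `choose` a
family S (junk 0 outside the window); it satisfies the normalised-family hypothesis of
EndpointContinuity (at αs := α_*), which yields T (pointwise limit, T₂ > 0, U₄ ≢ 0);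
EndpointIsNearestNeighbour makes T a scaling limit of criticalCorr 3; conclude by ThesisSuffices
(inlined). The four decls unfold definitionally to the abbreviated forms (Iff.rfl). -/
@[route_item "route-CriticalPhenomena-LongRangeEndpoint", crux]
def Assembly : Prop :=
  LRWindowConformal → ProtectedWindow → EndpointContinuity → EndpointIsNearestNeighbour → Ising3DConformalLimit

/-! D-0027 §2.1 — DECIDING THEOREM (planner-authored via `route open/edit --closes-file`; by planner-rchoice-CriticalPhenomena-LongRangeEnd-3e0a307e-0 2026-08-16T03:12:02Z):
its hypotheses are this route's items and its conclusion the sub-problem Statement (glue_lint), and it elaborates with this file. -/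

@[closes "route-CriticalPhenomena-LongRangeEndpoint"] theorem closes (h_EndpointThesis : EndpointThesis) (h_LRWindowConformal : LRWindowConformal) (h_EndpointIsNearestNeighbour : EndpointIsNearestNeighbour) (h_EndpointContinuity : EndpointContinuity) (h_ProtectedWindow : ProtectedWindow) (h_ThesisSuffices : ThesisSuffices) (h_Assembly : Assembly) (h_CruxesReachTarget : CruxesReachTarget) : _root_.Ising3DConformalLimit :=
  h_ThesisSuffices (h_CruxesReachTarget h_LRWindowConformal h_ProtectedWindow h_EndpointContinuity h_EndpointIsNearestNeighbour)

end Summit.CriticalPhenomena.Ising3DConformalLimit.Theses.LongRangeEndpoint
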